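import Literature.Computability.MetaComplexity.LanguageCompression
import Literature.Computability.MetaComplexity.UniversalHeuristicSchemesProofs
import Literature.Computability.Complexity.ListBricks
import Literature.Computability.Complexity.FoldBricks
import Literature.Computability.Complexity.UnaryBricks
import Literature.Computability.Complexity.SplitOnesBricks
import Literature.Computability.Complexity.PlumbingBricks
import Literature.Computability.Complexity.FPStringBricks
import HarnessLib

/-!
# Complexity meta: approximating `K^t(x)` from `Gap_τ(K vs K) ∈ pr-P` (Hirahara 2021, Fact 3.8)

Topic `Literature/Computability/MetaComplexity`, companion to `LanguageCompression.lean` (Def. 2.5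
`UniversalMachine.gapKvsK`, the named fact `Hirahara2021_gapKvsK_mem_PromiseP` = Lemma 5.1) for
S. Hirahara, *Average-case hardness of NP from exponential worst-case hardness assumptions*,
STOC 2021, full version ECCC TR21-058. **Fact 3.8 (1 ⇒ 2), PROVED:** *if `Gap_τ(K vs K) ∈ P` then
there exist a polynomial-time algorithm `M` and a polynomial `p_K` such that, on input `(x, 1ᵗ)`
with `t ≥ |x|`, `M` outputs an integer `v` with `K^{p_K(t)}(x) - log p_K(t) ≤ v ≤ K^t(x)`.* Printed
proof: `M(x, 1ᵗ) := min {s | M₀(x, 1ᵗ, 1ˢ) = 1}` for a separating algorithm `M₀`.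

We vendor the shifted form used in Eq. (12) of the proof of Thm. 8.9 ("the checker `C` computes a
value `s` such that `K^{p_K(t)}(x) ≤ s ≤ K^t(x) + log p_K(t)`"), with `p_K(t) := τ(|x| + t)`:

* `UniversalMachine.ktApprox S τ a₀ x t := j + log τ(|x| + t)`, where `j` is the least `s ≤ |x| + a₀`
  with `⟨x, 1ᵗ, 1ˢ⟩ ∈ S` (or `|x| + a₀ + 1` if there is none) — the printed `min`, scanned over the
  range in which `K^t(x)` lies (`K^t(x) ≤ |x| + a₀` for `t ≥ c₀`, `exists_ktAt_le_length_add`);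
* `ktApprox_ge`, `ktApprox_le` — for `t ≥ c₀` and `S` separating `Gap_τ(K vs K)`:
  `K^{τ(|x|+t)}(x) ≤ ktApprox ≤ K^t(x) + log τ(|x|+t)`;
* `polyTimeComputable_ktApprox` — it is polynomial-time on `(x, 1ᵗ) = paramEnc (x, t)` with unary
  output when `S ∈ P` (a counted loop building the mask of accepted `s`, `FP` bricks of the tree);
* `exists_ktApprox_of_gapKvsK_mem_PromiseP` — the packaged statement: from
  `Gap_τ(K vs K) ∈ pr-P` with `τ(m) ≥ m + 1`, an approximation `sK` with the two bounds and its
  polynomial-time computability, together with the printing constants `c₀, a₀`.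

The hypothesis "`t ≥ |x|`" of the printed Fact 3.8 serves to make `K^t(x)` finite; in the tree's
abstract universal machine this is `t ≥ c₀` (a constant), which is what the statements assume.

## References

* S. Hirahara, *Average-case hardness of NP from exponential worst-case hardness assumptions*,
  STOC 2021; full version ECCC TR21-058: Fact 3.8 (p. 22), proof of Thm. 8.9, Eq. (12) (p. 41).
* S. Arora, B. Barak, *Computational Complexity: A Modern Approach*, CUP 2009, §1.3 (bounded loops).
-/

namespace Literature.Computability.MetaComplexity

open _root_.Computability Complexity Complexity.Classes Brick Polynomial

/-! ### The approximation as a function -/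

/-- The acceptance bit `[⟨x, 1ᵗ, 1ˢ⟩ ∈ S]` of the separating language. [Hirahara 2021 (ECCC
TR21-058), Fact 3.8 (proof: `M(x, 1ᵗ, 1ˢ)`)] [cite: Hirahara2021, Fact 3.8 (proof)] -/
noncomputable def accBit (S : Set (List Bool)) (x : List Bool) (t s : ℕ) : Bool :=
  S.boolIndicator (boolPair x (boolPair (unaryEncodeNat t) (unaryEncodeNat s)))

/-- The negated mask `[¬ M₀(x, 1ᵗ, 1⁰), …, ¬ M₀(x, 1ᵗ, 1ᴮ)]` over the range `s ≤ B`. [Hirahara 2021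
(ECCC TR21-058), Fact 3.8 (proof)] [cite: Hirahara2021, Fact 3.8 (proof)] -/
noncomputable def negMask (S : Set (List Bool)) (x : List Bool) (t B : ℕ) : List Bool :=
  (List.range (B + 1)).map fun s => !accBit S x t s

/-- The least accepted `s ≤ B` (or `B + 1`): the number of leading `1`s of the negated mask.
[Hirahara 2021 (ECCC TR21-058), Fact 3.8 (proof: `min {s | M(x, 1ᵗ, 1ˢ) = 1}`)]
[cite: Hirahara2021, Fact 3.8 (proof)] -/
noncomputable def leastAcc (S : Set (List Bool)) (x : List Bool) (t B : ℕ) : ℕ :=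
  (splitOnes (negMask S x t B)).1

/-- **The approximation of Eq. (12)**: `ktApprox S τ a₀ x t := j + log τ(|x| + t)` with `j` the
least accepted `s ≤ |x| + a₀`. [Hirahara 2021 (ECCC TR21-058), Fact 3.8 and Eq. (12)]
[cite: Hirahara2021, Fact 3.8] -/
noncomputable def ktApprox (S : Set (List Bool)) (τ : Polynomial ℕ) (a₀ : ℕ) (x : List Bool) (t : ℕ) : ℕ :=
  leastAcc S x t (x.length + a₀) + Nat.log 2 (τ.eval (x.length + t))

/-- The mask has `B + 1` entries. [folklore] -/
@[simp] theorem length_negMask (S : Set (List Bool)) (x : List Bool) (t B : ℕ) :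
    (negMask S x t B).length = B + 1 := by
  simp [negMask]

/-- `splitOnes` counts the leading `1`s: on `1ʲ ‖ 0 ‖ r` it returns `j`, on `1ʲ` it returns `j`;
in general the count is the index of the first `0` (or the length). [folklore] -/
private theorem splitOnes_fst_map_range (f : ℕ → Bool) :
    ∀ (L i : ℕ), (∀ s, s < i → f s = true) →
      (splitOnes ((List.range' i L).map f)).1 = (((List.range' i L).map f).takeWhile (· == true)).length
  | 0, i, _ => by simp [splitOnes]
  | L + 1, i, h => by
    rw [List.range'_succ, List.map_cons]
    cases hf : f i with
    | false => simp [splitOnes]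
    | true =>
      simp only [splitOnes, List.takeWhile_cons]
      simp only [BEq.rfl, ite_true, List.length_cons]
      rw [splitOnes_fst_map_range f L (i + 1) fun s hs => ?_]
      rcases Nat.lt_succ_iff_lt_or_eq.1 hs with hs | rfl
      · exact h s hs
      · exact hf

/-- **The least accepted index is accepted, and everything before it is rejected.** If some
`s₀ ≤ B` is accepted then `leastAcc ≤ s₀` and `leastAcc` itself is accepted. [Hirahara 2021
(ECCC TR21-058), Fact 3.8 (proof)] [cite: Hirahara2021, Fact 3.8 (proof)] -/
theorem leastAcc_spec (S : Set (List Bool)) (x : List Bool) (t : ℕ) {B s₀ : ℕ} (hs₀ : s₀ ≤ B)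
    (hacc : accBit S x t s₀ = true) :
    leastAcc S x t B ≤ s₀ ∧ accBit S x t (leastAcc S x t B) = true := by
  unfold leastAcc negMask
  set f : ℕ → Bool := fun s => !accBit S x t s with hf
  have key : ∀ (L i : ℕ), i ≤ s₀ → s₀ < i + L →
      i + (((List.range' i L).map f).takeWhile (· == true)).length ≤ s₀ ∧
        accBit S x t (i + (((List.range' i L).map f).takeWhile (· == true)).length) = true := by
    intro L
    induction L with
    | zero => intro i hi hlt; omega
    | succ L ih =>
      intro i hi hlt
      rw [List.range'_succ, List.map_cons, List.takeWhile_cons]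
      cases hfi : f i with
      | false =>
        have : accBit S x t i = true := by simpa [hf] using hfi
        simpa using ⟨hi, this⟩
      | true =>
        have hne : i ≠ s₀ := by
          rintro rfl
          simp [hf, hacc] at hfi
        simp only [BEq.rfl, ite_true, List.length_cons]
        have := ih (i + 1) (by omega) (by omega)
        rw [show i + ((((List.range' (i + 1) L).map f).takeWhile (· == true)).length + 1) =
          i + 1 + (((List.range' (i + 1) L).map f).takeWhile (· == true)).length by ring]
        exact this
  have h := key (B + 1) 0 (Nat.zero_le _) (by omega)
  rw [List.range_eq_range', splitOnes_fst_map_range f (B + 1) 0 (fun s hs => absurd hs (Nat.not_lt_zero s))]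
  simpa using h

/-! ### The two bounds of Eq. (12) -/

namespace UniversalMachine

variable (U : UniversalMachine)

/-- **Upper bound (`s ≤ K^t(x) + log τ(|x|+t)`).** If `S` contains `MINKT` (the yes-part of
`Gap_τ(K vs K)`) and `K^t(x) ≤ |x| + a₀`, then the least accepted index is `≤ K^t(x)`.
[Hirahara 2021 (ECCC TR21-058), Fact 3.8 (proof: "since `M(x, 1ᵗ, 1^{K^t(x)}) = 1`, we have
`v ≤ K^t(x)`")] [cite: Hirahara2021, Fact 3.8 (proof)] -/
theorem ktApprox_le {S : Set (List Bool)} {τ : Polynomial ℕ} {a₀ : ℕ} (hyes : U.MINKT ≤ S)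
    {x : List Bool} {t : ℕ} (hK : U.ktAt t x ≤ x.length + a₀) :
    (ktApprox S τ a₀ x t : ℕ∞) ≤ U.ktAt t x + Nat.log 2 (τ.eval (x.length + t)) := by
  have hne : U.ktAt t x ≠ ⊤ := ne_top_of_le_ne_top (ENat.coe_ne_top _) hK
  obtain ⟨A, hA⟩ : ∃ A : ℕ, U.ktAt t x = A := ⟨(U.ktAt t x).toNat, (ENat.coe_toNat hne).symm⟩
  rw [hA] at hK ⊢
  have hAle : A ≤ x.length + a₀ := by exact_mod_cast hK
  have hacc : accBit S x t A = true := by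
    unfold accBit
    exact (Set.mem_iff_boolIndicator _ _).1 (hyes (U.boolPair_mem_MINKT_iff.2 hA.le))
  have h := (leastAcc_spec S x t hAle hacc).1
  unfold ktApprox
  exact_mod_cast Nat.add_le_add_right h _

/-- **Lower bound (`K^{τ(|x|+t)}(x) ≤ s`).** If `S` contains `MINKT` and avoids the no-part of
`Gap_τ(K vs K)`, and `K^t(x) ≤ |x| + a₀`, then `K^{τ(|x|+t)}(x) ≤ ktApprox`: the least accepted index
`j` is accepted, hence `⟨x, 1ᵗ, 1ʲ⟩` is not a no-instance. [Hirahara 2021 (ECCC TR21-058), Fact 3.8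
(proof: "since `M(x, 1ᵗ, 1ˢ) = 0` for every `s` with `K^{τ(|x|+t)}(x) > s + log τ(|x|+t)`, we obtain
`v ≥ K^{τ} - log τ`")] [cite: Hirahara2021, Fact 3.8 (proof)] -/
theorem ktApprox_ge {S : Set (List Bool)} {τ : Polynomial ℕ} {a₀ : ℕ} (hyes : U.MINKT ≤ S)
    (hno : (U.gapKvsK fun m => τ.eval m).no ≤ Sᶜ) {x : List Bool} {t : ℕ}
    (hK : U.ktAt t x ≤ x.length + a₀) :
    U.ktAt (τ.eval (x.length + t)) x ≤ ktApprox S τ a₀ x t := by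
  have hne : U.ktAt t x ≠ ⊤ := ne_top_of_le_ne_top (ENat.coe_ne_top _) hK
  obtain ⟨A, hA⟩ : ∃ A : ℕ, U.ktAt t x = A := ⟨(U.ktAt t x).toNat, (ENat.coe_toNat hne).symm⟩
  have hAle : A ≤ x.length + a₀ := by rw [hA] at hK; exact_mod_cast hK
  have hacc : accBit S x t A = true := by
    unfold accBit
    exact (Set.mem_iff_boolIndicator _ _).1 (hyes (U.boolPair_mem_MINKT_iff.2 hA.le))
  have hj := (leastAcc_spec S x t hAle hacc).2
  set j := leastAcc S x t (x.length + a₀) with hjdef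
  have hmem : boolPair x (boolPair (unaryEncodeNat t) (unaryEncodeNat j)) ∈ S := by
    unfold accBit at hj
    exact (Set.mem_iff_boolIndicator _ _).2 hj
  have hnot : boolPair x (boolPair (unaryEncodeNat t) (unaryEncodeNat j)) ∉ (U.gapKvsK fun m => τ.eval m).no :=
    fun h => hno h hmem
  rw [U.boolPair_mem_gapKvsK_no_iff] at hnot
  unfold ktApprox
  exact not_lt.1 hnot

end UniversalMachine

/-! ### Polynomial-time computability -/

section Machine

variable (τ : Polynomial ℕ) (a₀ : ℕ)

/-- The test `⟨x, ⟨1ᵗ, 1ˢ⟩⟩ ↦ [¬ (· ∈ S)]` on the assembled triple, from the loop record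
`⟨yard, ⟨cnt, ⟨⟨x, 1ᵗ⟩, ⟨1ˢ, acc⟩⟩⟩⟩`. [folklore] -/
noncomputable def tripleF : List Bool → List Bool :=
  fanoutFn (fstF ∘ nthF 2) (fanoutFn (sndF ∘ nthF 2) (nthF 3))

/-- One round of the mask loop: `⟨q, ⟨1ˢ, acc⟩⟩ ↦ ⟨q, ⟨1ˢ⁺¹, acc ‖ [¬ M₀(q, 1ˢ)]⟩⟩` (as a function
of the whole record). [Hirahara 2021 (ECCC TR21-058), Fact 3.8 (proof)] [folklore] -/
noncomputable def maskBody (negTest : List Bool → List Bool) : List Bool → List Bool :=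
  fanoutFn (nthF 2) (fanoutFn (List.cons true ∘ nthF 3) (fun z => sndPow 3 z ++ negTest (tripleF z)))

/-- The yardstick `x ‖ 1^{a₀+1}` (one round per candidate `s ≤ |x| + a₀`). [folklore] -/
def yardF : List Bool → List Bool := fun w => fstF w ++ ones (a₀ + 1)

/-- The initial record `⟨yard, ⟨bin |yard|, ⟨w, ⟨ε, ε⟩⟩⟩⟩` from the input `w = ⟨x, 1ᵗ⟩`. [folklore] -/
noncomputable def maskSetup : List Bool → List Bool :=
  fanoutFn (yardF a₀) (fanoutFn (lenBinF ∘ yardF a₀) (fanoutFn id (fanoutFn (fun _ => []) (fun _ => []))))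

/-- The mask part of the algorithm: loop, read off the mask, count its leading `1`s.
[Hirahara 2021 (ECCC TR21-058), Fact 3.8 (proof)] [folklore] -/
noncomputable def maskPart (negTest : List Bool → List Bool) : List Bool → List Bool :=
  onesPrefixFn ∘ sndPow 3 ∘ loopX (maskBody negTest) ∘ maskSetup a₀

/-- The logarithmic shift `⟨x, 1ᵗ⟩ ↦ 1^{log τ(|x|+t)}`. [Hirahara 2021 (ECCC TR21-058), Eq. (12)]
[folklore] -/
noncomputable def logPart : List Bool → List Bool :=
  logFn ∘ Plumb.polyFn τ ∘ fun w => fstF w ++ sndF w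

/-- The whole algorithm of Fact 3.8 with the shift of Eq. (12): `1^{j} ‖ 1^{log τ(|x|+t)}`.
[Hirahara 2021 (ECCC TR21-058), Fact 3.8 (proof)] [folklore] -/
noncomputable def ktApproxF (negTest : List Bool → List Bool) : List Bool → List Bool :=
  fun w => maskPart a₀ negTest w ++ logPart τ w

variable {τ a₀}

/-- The loop invariant: `r` rounds from `⟨q, ⟨1ⁱ, acc⟩⟩` reach `⟨q, ⟨1ⁱ⁺ʳ, acc ‖ bits i … i+r-1⟩⟩`.
[folklore] -/
theorem loopModel_maskBody (negTest : List Bool → List Bool) (yard q : List Bool) (g : ℕ → Bool)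
    (hneg : ∀ s : ℕ, negTest (boolPair (fstF q) (boolPair (sndF q) (ones s))) = [g s]) :
    ∀ (r i : ℕ) (acc : List Bool),
    loopModel (maskBody negTest) yard r (boolPair q (boolPair (ones i) acc)) =
      boolPair q (boolPair (ones (i + r)) (acc ++ (List.range' i r).map g))
  | 0, i, acc => by simp [loopModel]
  | r + 1, i, acc => by
    rw [loopModel]
    have hbody : maskBody negTest (boolPair yard (boolPair (encodeNat (r + 1)) (boolPair q (boolPair (ones i) acc)))) =
        boolPair q (boolPair (ones (i + 1)) (acc ++ [g i])) := by
      simp only [maskBody, tripleF, fanoutFn_apply, Function.comp_apply, nthF_succ_boolPair,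
        nthF_zero_boolPair, sndPow_succ_boolPair, sndPow_zero_boolPair, hneg i]
      rfl
    rw [hbody, loopModel_maskBody negTest yard q g hneg r (i + 1) (acc ++ [g i]), List.range'_succ,
      List.map_cons, List.append_assoc, List.singleton_append, Nat.add_right_comm, Nat.add_assoc]

/-- **Semantics**: `ktApproxF` computes `1^{ktApprox}` on `⟨x, 1ᵗ⟩`. [Hirahara 2021 (ECCC TR21-058),
Fact 3.8 (proof)] [folklore] -/
theorem ktApproxF_paramEnc (S : Set (List Bool)) (τ : Polynomial ℕ) (a₀ : ℕ) (negTest : List Bool → List Bool)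
    (hneg : ∀ v : List Bool, negTest v = [!S.boolIndicator v]) (x : List Bool) (t : ℕ) :
    ktApproxF τ a₀ negTest (paramEnc (x, t)) = unaryEncodeNat (ktApprox S τ a₀ x t) := by
  have hyard : yardF a₀ (paramEnc (x, t)) = x ++ ones (a₀ + 1) := by simp [yardF, paramEnc]
  have hsetup : maskSetup a₀ (paramEnc (x, t)) =
      boolPair (x ++ ones (a₀ + 1)) (boolPair (encodeNat (x.length + a₀ + 1))
        (boolPair (paramEnc (x, t)) (boolPair (ones 0) []))) := by
    simp [maskSetup, fanoutFn_apply, hyard, ones, Nat.add_assoc]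
  set q := paramEnc (x, t) with hq
  have hg : ∀ s : ℕ, negTest (boolPair (fstF q) (boolPair (sndF q) (ones s))) =
      [!S.boolIndicator (boolPair (fstF q) (boolPair (sndF q) (ones s)))] := fun s => hneg _
  have hloop := loopX_apply (maskBody negTest) (x ++ ones (a₀ + 1))
    (boolPair q (boolPair (ones 0) [])) (k := x.length + a₀ + 1) (by simp)
  rw [loopModel_maskBody negTest _ q _ hg] at hloop
  have hmask : (List.range' 0 (x.length + a₀ + 1)).map
      (fun s => !S.boolIndicator (boolPair (fstF q) (boolPair (sndF q) (ones s)))) =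
      negMask S x t (x.length + a₀) := by
    simp [hq, negMask, accBit, paramEnc, List.range_eq_range', ones, OracleCompose.unaryEncodeNat_eq_replicate]
  simp only [ktApproxF, maskPart, logPart, Function.comp_apply]
  rw [hsetup, hloop]
  simp only [sndPow_succ_boolPair, sndPow_zero_boolPair, List.nil_append, zero_add]
  rw [hmask, onesPrefixFn]
  simp [hq, paramEnc, Plumb.polyFn_apply, logFn, ktApprox, leastAcc, ones,
    OracleCompose.unaryEncodeNat_eq_replicate]

/-- `tripleF ∈ FP`. [folklore] -/
theorem tripleF_mem_FP : tripleF ∈ FP :=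
  fanoutFn_mem_FP (comp_mem_FP fstF_mem_FP (nthF_mem_FP 2))
    (fanoutFn_mem_FP (comp_mem_FP sndF_mem_FP (nthF_mem_FP 2)) (nthF_mem_FP 3))

/-- `maskBody negTest ∈ FP` for `negTest ∈ FP`. [folklore] -/
theorem maskBody_mem_FP {negTest : List Bool → List Bool} (h : negTest ∈ FP) : maskBody negTest ∈ FP :=
  fanoutFn_mem_FP (nthF_mem_FP 2) (fanoutFn_mem_FP (comp_mem_FP (cons_mem_FP true) (nthF_mem_FP 3))
    (append_mem_FP (sndPow_mem_FP 3) (comp_mem_FP h tripleF_mem_FP)))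

/-- **Growth of one round**: the state grows by at most `3` symbols when the test is one bit.
[folklore] -/
theorem length_maskBody_le {negTest : List Bool → List Bool} (h1 : OneBit negTest) (z : List Bool) :
    (maskBody negTest z).length ≤ (sndPow 1 z).length + (Polynomial.C 7 : Polynomial ℕ).eval (fstF z).length := by
  obtain ⟨b, hb⟩ := h1 (tripleF z)
  simp only [maskBody, fanoutFn_apply, Function.comp_apply, hb, Polynomial.eval_C]
  rw [length_boolPair, length_boolPair]
  simp only [List.length_cons, List.length_append, List.length_nil]
  -- the components are pieces of the state `sndPow 1 z`
  have e2 := length_nthF_succ_add_sndPow_succ_le 1 z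
  have e3 := length_nthF_succ_add_sndPow_succ_le 2 z
  simp only [Nat.reduceAdd] at e2 e3
  omega

/-- `maskSetup ∈ FP`. [folklore] -/
theorem maskSetup_mem_FP (a₀ : ℕ) : maskSetup a₀ ∈ FP := by
  have hy : yardF a₀ ∈ FP := by
    have h : (fun w : List Bool => fstF w ++ ones (a₀ + 1)) ∈ FP :=
      append_mem_FP fstF_mem_FP (const_mem_FP (ones (a₀ + 1)))
    exact h
  have h2 : lenBinF ∘ yardF a₀ ∈ FP := comp_mem_FP lenBinF_mem_FP hy
  have h3 : fanoutFn (id : List Bool → List Bool)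
      (fanoutFn (fun _ : List Bool => ([] : List Bool)) (fun _ : List Bool => ([] : List Bool))) ∈ FP :=
    fanoutFn_mem_FP OracleCompose.id_mem_FP (fanoutFn_mem_FP (const_mem_FP []) (const_mem_FP []))
  exact fanoutFn_mem_FP hy (fanoutFn_mem_FP h2 h3)

/-- **`ktApproxF ∈ FP`** for a one-bit `negTest ∈ FP`. [Hirahara 2021 (ECCC TR21-058), Fact 3.8
("polynomial-time algorithm")] [folklore] -/
theorem ktApproxF_mem_FP (τ : Polynomial ℕ) (a₀ : ℕ) {negTest : List Bool → List Bool} (h : negTest ∈ FP)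
    (h1 : OneBit negTest) : ktApproxF τ a₀ negTest ∈ FP := by
  have hm : maskPart a₀ negTest ∈ FP := by
    unfold maskPart
    exact comp_mem_FP onesPrefixFn_mem_FP (comp_mem_FP (sndPow_mem_FP 3)
      (comp_mem_FP (loopX_mem_FP (maskBody_mem_FP h) (length_maskBody_le h1)) (maskSetup_mem_FP a₀)))
  have hl : logPart τ ∈ FP := by
    unfold logPart
    exact comp_mem_FP logFn_mem_FP (comp_mem_FP (Plumb.polyFn_mem_FP τ) (append_mem_FP fstF_mem_FP sndF_mem_FP))
  unfold ktApproxF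
  exact append_mem_FP hm hl

end Machine

/-- **`ktApprox` is polynomial-time** on `(x, 1ᵗ)` with unary output, when `S ∈ P`.
[Hirahara 2021 (ECCC TR21-058), Fact 3.8] [cite: Hirahara2021, Fact 3.8] -/
theorem polyTimeComputable_ktApprox {S : Set (List Bool)} (hS : S ∈ P) (τ : Polynomial ℕ) (a₀ : ℕ) :
    PolyTimeComputable paramEnc unaryEncodeNat (Function.uncurry (ktApprox S τ a₀)) := by
  -- the negated membership test as a one-bit `FP` function
  obtain ⟨r, M, hM⟩ := polyTimeDecidable_iff.1 (mem_P_iff_holds.1 hS)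
  have hdec : (fun z : List Bool => encodeBool (S.boolIndicator z)) ∈ FP := ⟨r, M, fun z => hM z⟩
  set negTest : List Bool → List Bool := notFn fun z => encodeBool (S.boolIndicator z) with hnt
  have hneg : ∀ v, negTest v = [!S.boolIndicator v] := fun v => notFn_apply rfl
  have hFP : ktApproxF τ a₀ negTest ∈ FP :=
    ktApproxF_mem_FP τ a₀ (notFn_mem_FP hdec) (oneBit_notFn fun z => ⟨_, rfl⟩)
  obtain ⟨q, M', hM'⟩ := hFP
  refine ⟨q, M', ?_⟩
  rintro ⟨x, t⟩
  have h := hM' (paramEnc (x, t))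
  rw [ktApproxF_paramEnc S τ a₀ negTest hneg x t] at h
  exact h

/-! ### Fact 3.8, packaged for the toolkit of Thm. 8.9 -/

namespace UniversalMachine

variable (U : UniversalMachine)

/-- **Hirahara 2021, Fact 3.8 (1 ⇒ 2), with Eq. (12).** If `Gap_τ(K vs K) ∈ pr-P` for a polynomial
`τ` with `τ(m) ≥ m + 1`, then there are constants `c₀, a₀` and a polynomial-time (on `(x, 1ᵗ)`,
unary output) function `sK` such that for all `x` and all `t ≥ c₀`: `K^t(x) ≤ |x| + a₀`,
`K^{τ(|x|+t)}(x) ≤ sK(x, t)` and `sK(x, t) ≤ K^t(x) + log τ(|x|+t)`. [Hirahara 2021 (ECCC TR21-058),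
Fact 3.8; proof of Thm. 8.9, Eq. (12)] [cite: Hirahara2021, Fact 3.8] -/
theorem exists_ktApprox_of_gapKvsK_mem_PromiseP {τ : Polynomial ℕ}
    (hS : U.gapKvsK (fun m => τ.eval m) ∈ PromiseP) :
    ∃ (c₀ a₀ : ℕ) (sK : List Bool → ℕ → ℕ),
      PolyTimeComputable paramEnc unaryEncodeNat (Function.uncurry sK) ∧
      (∀ (x : List Bool) (t : ℕ), c₀ ≤ t → U.ktAt t x ≤ x.length + a₀) ∧
      (∀ (x : List Bool) (t : ℕ), c₀ ≤ t → U.ktAt (τ.eval (x.length + t)) x ≤ sK x t) ∧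
      (∀ (x : List Bool) (t : ℕ), c₀ ≤ t → (sK x t : ℕ∞) ≤ U.ktAt t x + Nat.log 2 (τ.eval (x.length + t))) := by
  obtain ⟨S, hSP, hyes, hno⟩ := hS
  obtain ⟨c₀, a₀, hka⟩ := U.exists_ktAt_le_length_add
  exact ⟨c₀, a₀, ktApprox S τ a₀, polyTimeComputable_ktApprox hSP τ a₀, hka,
    fun x t ht => U.ktApprox_ge hyes hno (hka x t ht), fun x t ht => U.ktApprox_le hyes (hka x t ht)⟩

end UniversalMachine

end Literature.Computability.MetaComplexity
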